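import Summits.QuantumFields.YangMills.Theorems.BalabanLadderUVOtherGroupsDefs
import Summits.QuantumFields.YangMills.Theorems.BalabanLadderUVRecord13
import HarnessLib

/-!
# Route `BalabanLadder`, crux `UVOtherGroups` (stmt-QuantumFields-19356): the STAGE-13 pinned-record UV packages ⇒ `UVD59 N` ∕ `UVApexSUN` ∕ `UVSUN` BY NAME

Helper file (`--supports stmt-QuantumFields-19356`, fleet seat `ym-osasm-p2`, director-ym R136 (iii)); pure theorems, one line each; the Stage-13 twin of
`Theorems/BalabanLadderUVOtherGroupsApexRecord12Pkg.lean` (p470271).  ★ym-osasm-p1 g5 named Track A's REV-16 output ONE LINE BEFORE the Stage-0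
projection as two route-independent packages (`Theorems/BalabanLadderUVRecord13Defs.lean`, p489475): `Cruxes.UV.Record13.UVAtParams13 N` (θ-keyed, RECORD 13
= `Node00/Record13.lean` v1.1) and `UVAtRecord13C N` ((D, w)-keyed), with kernels `uvAtParams13_of_chain` (the four rev-16 item texts with `2 ↦ N`,
INLINE) and `stage0_of_uvAtParams13` ∕ `stage0_of_uvAtRecord13C` whose conclusions are VERBATIM the body of `YMDAG.UVSplit.UVD59 N` (p489689).  Those
modules import no `Theses` file by design, so they cannot name the `SU(N)` leaf or this seat's vocabulary; THIS file states the junctions BY NAME, for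
every `N`:

* `uvD59_of_uvAtParams13`, `uvD59_of_uvAtRecord13C` — package ⇒ `YMDAG.UVSplit.UVD59 N`;
* `uvD59_of_theta16Chain` — the four rev-16 item texts at `SU(N)` (INLINE, = the hypotheses of `uvAtParams13_of_chain`) ⇒ `UVD59 N`: the composition
  of the `UVApexSUN` birth-skeleton candidate re-keyed to rev 16 (owner R85 rev 3h Δ16: 4-stub 89b09208a3cdfca6 «RE-KEYED to Track A's rev-16 four the
  hour [R1] lands»; desk `pub/ym-fleet/ym-osasm-p2/UVApexSUN-birth-candidate-rev16.lean`);
* `uvApexSUN_of_uvAtParams13`, `uvApexSUN_of_uvAtRecord13C` — `∀ N ≥ 3` packages ⇒ the R85 binder body `∀ N ≥ 3, UVD59 N` (`UVApexSUN`, spelling (S0));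
  i.e. the (θ)-at-Record-13 spelling of item 2 (★osasm-p1 03:00:20Z: `∀ N ≥ 3, Cruxes.UV.Record13.UVAtParams13 N`) IMPLIES the default (S0) spelling
  (owner rev 3g Δ7 ∕ rev 3h Δ15);
* `uvSUN_of_uvAtParams13`, `uvSUN_of_uvAtRecord13C` — `∀ N ≥ 2` packages ⇒ `UVSUN`.

EDIT-SAFETY (R85): no `N = 2` junction to `Theses.BalabanLadder.UV` is stated here (those ride the tether `YMDAG.UVSplit.uvD59_two_iff`, whose fate is the
owner's [R1] decision; ★osasm-p1 holds the `N = 2` junction scratch J1–J3) — every conclusion below is `UVD59 N`-valued or this seat's `Theses`-free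
vocabulary, so the module survives item 1 under either E1 text and item 3.  HONEST FRAMING: bookkeeping of a CONDITIONAL chain (0∕6 legs); the packages
are Bałaban's programme per `SU(N)`, OPEN (Track A: typed 28∕28, discharged 5∕27 at node level, for `N = 2`); not a gap, not Clay.
-/

set_option autoImplicit false

noncomputable section

open Literature.MathematicalPhysics.QuantumFieldTheory.Balaban1983to89
open Literature.MathematicalPhysics.QuantumFieldTheory.Balaban1983to89.T4Continuum
open Summit.QuantumFields.YangMills.Cruxes.UV.Record13

namespace Summit.QuantumFields.YangMills.Theorems.UVOtherGroups

section Pkg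

variable {N : ℕ} [NeZero N]

/-- **θ-keyed Stage-13 package ⇒ the `SU(N)` leaf `UVD59 N`** (p1's `stage0_of_uvAtParams13`, by name). -/
theorem uvD59_of_uvAtParams13 (h : UVAtParams13 N) : YMDAG.UVSplit.UVD59 N :=
  fun F => stage0_of_uvAtParams13 h F

/-- **(D, w)-keyed Stage-13 package ⇒ the `SU(N)` leaf `UVD59 N`** (p1's `stage0_of_uvAtRecord13C`, by name). -/
theorem uvD59_of_uvAtRecord13C (h : UVAtRecord13C N) : YMDAG.UVSplit.UVD59 N :=
  fun F => stage0_of_uvAtRecord13C h F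

/-- **THE REV-16 CHAIN AT `SU(N)` ⇒ `UVD59 N`**: the four announced rev-16 item texts of `route-QuantumFields-BalabanUVNodes` with `2 ↦ N` — K0‴
`Record13Inhabited` (admissible unity tuples with non-degenerate slots exist) · K1‴ `StabilityBAtRecordR13e` ((B) + the non-vacuity window at some such
tuple) · K2‴ `EndpointGivenBR13` (END given (B) + window) · K3‴ `SpineGivenEndpointR13` (the hybrid-NE7 spine given (B) + END) — compose through p1's
`uvAtParams13_of_chain` and the Stage-0 projection to the `SU(N)` leaf.  At `N ≥ 3` these four texts are the stubs of the `UVApexSUN` birth-skeleton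
candidate re-keyed to rev 16; all four are Bałaban's programme per `SU(N)`, OPEN. -/
theorem uvD59_of_theta16Chain
    (h0 : ∀ F : T4Family, ∃ θ : Node00.Stage13Params F N, θ.Provisos₁₃ F N ∧ (θ.ZtUnity F N ∧ θ.SlotsNondegenerate₁₃ F N) ∧ θ.Admissible F N)
    (h1 : ∀ F : T4Family, (∃ θ : Node00.Stage13Params F N, θ.Provisos₁₃ F N ∧ (θ.ZtUnity F N ∧ θ.SlotsNondegenerate₁₃ F N) ∧ θ.Admissible F N) →
      ∃ (θ : Node00.Stage13Params F N) (h : θ.Provisos₁₃ F N), (θ.ZtUnity F N ∧ θ.SlotsNondegenerate₁₃ F N) ∧ θ.Admissible F N ∧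
        B16.EndStatementBPrinted (Node00.datumOfRecord₁₃ F N θ h).C ∧ ∃ γ₁ : ℝ, 0 < γ₁ ∧ ∀ γ : ℝ, 0 < γ → γ ≤ γ₁ →
          ∃ P : B12.RunParams, 1 ≤ P.K ∧ ((Node00.datumOfRecord₁₃ F N θ h).C P).flow.InInterval γ P.K)
    (h2 : ∀ (F : T4Family) (θ : Node00.Stage13Params F N) (h : θ.Provisos₁₃ F N), (θ.ZtUnity F N ∧ θ.SlotsNondegenerate₁₃ F N) → θ.Admissible F N →
      B16.EndStatementBPrinted (Node00.datumOfRecord₁₃ F N θ h).C → (∃ γ₁ : ℝ, 0 < γ₁ ∧ ∀ γ : ℝ, 0 < γ → γ ≤ γ₁ →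
        ∃ P : B12.RunParams, 1 ≤ P.K ∧ ((Node00.datumOfRecord₁₃ F N θ h).C P).flow.InInterval γ P.K) →
      DagBinding.EndpointExistence (Node00.datumOfRecord₁₃ F N θ h).C.toB12)
    (h3 : ∀ (F : T4Family) (θ : Node00.Stage13Params F N) (h : θ.Provisos₁₃ F N), (θ.ZtUnity F N ∧ θ.SlotsNondegenerate₁₃ F N) → θ.Admissible F N →
      B16.EndStatementBPrinted (Node00.datumOfRecord₁₃ F N θ h).C → DagBinding.EndpointExistence (Node00.datumOfRecord₁₃ F N θ h).C.toB12 →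
      T4ApexHybrid.HybridNE7Under (Node00.datumOfRecord₁₃ F N θ h) (DagBinding.EndpointExistence (Node00.datumOfRecord₁₃ F N θ h).C.toB12)) :
    YMDAG.UVSplit.UVD59 N :=
  uvD59_of_uvAtParams13 (uvAtParams13_of_chain h0 h1 h2 h3)

end Pkg

/-- **θ-keyed Stage-13 packages for all `N ≥ 3` ⇒ the R85 binder body `UVApexSUN`** (`∀ N ≥ 3, YMDAG.UVSplit.UVD59 N`): spelling (θ) at Record 13 ⇒
spelling (S0). -/
theorem uvApexSUN_of_uvAtParams13 (h : ∀ (N : ℕ) [NeZero N], 3 ≤ N → UVAtParams13 N) :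
    ∀ (N : ℕ) [NeZero N], 3 ≤ N → YMDAG.UVSplit.UVD59 N :=
  fun N _ hN => uvD59_of_uvAtParams13 (h N hN)

/-- (D, w)-keyed Stage-13 packages for all `N ≥ 3` ⇒ `∀ N ≥ 3, YMDAG.UVSplit.UVD59 N`. -/
theorem uvApexSUN_of_uvAtRecord13C (h : ∀ (N : ℕ) [NeZero N], 3 ≤ N → UVAtRecord13C N) :
    ∀ (N : ℕ) [NeZero N], 3 ≤ N → YMDAG.UVSplit.UVD59 N :=
  fun N _ hN => uvD59_of_uvAtRecord13C (h N hN)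

/-- θ-keyed Stage-13 packages for all `N ≥ 2` ⇒ `UVSUN`. -/
theorem uvSUN_of_uvAtParams13 (h : ∀ (N : ℕ) [NeZero N], 2 ≤ N → UVAtParams13 N) : UVSUN :=
  fun N _ hN => uvD59_of_uvAtParams13 (h N hN)

/-- (D, w)-keyed Stage-13 packages for all `N ≥ 2` ⇒ `UVSUN`. -/
theorem uvSUN_of_uvAtRecord13C (h : ∀ (N : ℕ) [NeZero N], 2 ≤ N → UVAtRecord13C N) : UVSUN :=
  fun N _ hN => uvD59_of_uvAtRecord13C (h N hN)

end Summit.QuantumFields.YangMills.Theorems.UVOtherGroups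

end
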